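import Summits.ABC.StewartYu.PadicG3Exits
import HarnessLib

/-!
# The `p`-adic Gen-3 parameter record — part B: the floors and the point schedule in real form

Support file (plain theorems and one closed form; no named facts). Continues `PadicG3Par`/`PadicG3ParA`
(p1) and `PadicG3Exits` (lp-1: `G_le_yload`, `main_le_L'`, `one_le_X`), K-M3.1 page
HOME/p1/K-M3-1-padic-ledger.md §1/§4:

* the FLOORS the landed closed forms already imply: **`36 (n+1) ≤ X`** (so `X ≥ 72` and the integer
  parts of the schedule never bite), `H ≤ G X/(64(n+1))`, `X ≤ 9 H`, `L₀ ≤ G X L/(4·yload) + 1`,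
  `60 ≤ C_bⁿ Ω K`, `yload ≤ G L/1440`, `W + log(2L) + 1 ≤ W_L`, `(n+1)·L·W_L ≤ G X L/64`,
  `Mord 0 0 ≤ (28/27) M`, `n ≤ G/8 − 1`;
* the SCHEDULE in real form: `X_s (T_s+1) ≤ 4 X L`, `4 X L − (T_s+1) ≤ X_s (T_s+1)`, hence
  **`(31/8) X L ≤ X_s (T_s + 1)`**, `1 ≤ X_s`, `X_s ≤ 2^s X/2`, and the Schwarz exponent available at
  stage `(s, ν)`: `zeros s ν = G · (2^{ν+1} X_s) · (T_s + 1) ≥ (31/4)·2^ν·G X L` (gain `G` per zero at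
  `≥ 2^{ν+1} X_s` integer nodes of multiplicity `T_s + 1`, the exponent of `PadicG3KStep.norm_g3F_le_of_zeros`).

## References
* [Nesterenko2003] Yu. V. Nesterenko, *Linear forms in logarithms of rational numbers*, LNM 1819
  (2003) 53–106 — §3.5 (3.23)–(3.25), (4.3), (4.24)–(4.25).
-/

noncomputable section

open Finset Real

namespace Summit.ABC.StewartYu

namespace PadicG3Par

variable {n : ℕ} (P : PadicG3Par n)

/-! ### Floors implied by the closed forms -/

/-- `0 < yload`. [folklore] -/
theorem yload_pos : 0 < P.yload := lt_of_lt_of_le (by linarith [P.eight_le_G]) P.G_le_yload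

/-- `0 < C_b`. [folklore] -/
theorem Cb_pos : (0 : ℝ) < Cb := by unfold Cb cM; positivity

/-- `0 < C_bⁿ Ω K` (the Siegel core). [folklore] -/
theorem core_pos : 0 < Cb ^ n * P.Ω * P.K := by
  have := P.Ω_pos; have := P.K_pos; have := Cb_pos; positivity

/-- `C_bⁿ Ω K ≤ L G/(24 · yload)`. [folklore] -/
theorem core_le : Cb ^ n * P.Ω * P.K ≤ P.L * P.G / (24 * P.yload) := by
  have h := P.main_le_L
  have hG : 0 < P.G := by linarith [P.eight_le_G]
  have hY := P.yload_pos
  rw [le_div_iff₀ (by positivity)]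
  rw [div_le_iff₀ hG] at h
  linarith

/-- **`36 (n+1) ≤ X`** (the second term of `X` and `24 C_bⁿ Ω K ≤ L`): the number of points is never
small, so the integer parts of the schedule are harmless. [cite: Nesterenko2003, Prop 3.9] -/
theorem X_ge : (36 : ℝ) * (n + 1) ≤ P.X := by
  have hX : (3 / 2 : ℝ) * (n + 1) * P.L / (Cb ^ n * P.Ω * P.K) ≤ P.X := by
    have : (⌈(3 / 2 : ℝ) * (n + 1) * P.L / (Cb ^ n * P.Ω * P.K)⌉₊ : ℝ) ≤ P.X := by
      unfold X; exact_mod_cast le_max_right _ _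
    exact (Nat.le_ceil _).trans this
  have hc := P.core_pos
  have hL := P.main_le_L'
  rw [div_le_iff₀ hc] at hX
  have h0 : (0 : ℝ) ≤ n + 1 := by positivity
  nlinarith [mul_le_mul_of_nonneg_left hL h0]

/-- `72 ≤ X`. [folklore] -/
theorem seventytwo_le_X : (72 : ℝ) ≤ P.X := by
  have h := P.X_ge
  have h1 : (1 : ℝ) ≤ n := by exact_mod_cast P.hn
  nlinarith

/-- `72 ≤ X` (natural numbers). [folklore] -/
theorem seventytwo_le_X' : 72 ≤ P.X := by exact_mod_cast P.seventytwo_le_X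

/-- the directional term of `X`: `64 (n+1) W_L / G ≤ X`. [folklore] -/
theorem main_le_X : 64 * (n + 1) * P.WL / P.G ≤ P.X := by
  have h : (⌈64 * (n + 1) * P.WL / P.G⌉₊ : ℝ) ≤ P.X := by
    unfold X; exact_mod_cast le_max_left _ _
  exact (Nat.le_ceil _).trans h

/-- `W_L = 1 + log(1 + 2 e^W L)`. [folklore] -/
theorem WL_eq : P.WL = 1 + Real.log (1 + 2 * Real.exp P.W * P.L) := by
  unfold WL
  rw [Real.log_mul (Real.exp_pos 1).ne' (by positivity), Real.log_exp]

/-- **`W + log(2L) + 1 ≤ W_L`**: the one size-logarithm dominates `log B`, `log L`. [folklore] -/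
theorem W_add_log_le_WL : P.W + Real.log (2 * P.L) + 1 ≤ P.WL := by
  rw [P.WL_eq]
  have hL : (0 : ℝ) < P.L := by linarith [P.one_le_L]
  have h1 : Real.log (2 * Real.exp P.W * P.L) ≤ Real.log (1 + 2 * Real.exp P.W * P.L) :=
    Real.log_le_log (by positivity) (by linarith)
  have h2 : Real.log (2 * Real.exp P.W * P.L) = P.W + Real.log (2 * P.L) := by
    rw [show 2 * Real.exp P.W * P.L = Real.exp P.W * (2 * P.L) by ring,
      Real.log_mul (Real.exp_pos _).ne' (by positivity), Real.log_exp]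
  linarith

/-- `log(2L) ≤ W_L` and `log L ≤ W_L`. [folklore] -/
theorem log_L_le_WL : Real.log P.L ≤ P.WL := by
  have h := P.W_add_log_le_WL
  have hL : (0 : ℝ) < P.L := by linarith [P.one_le_L]
  have h1 : Real.log P.L ≤ Real.log (2 * P.L) := Real.log_le_log hL (by linarith)
  linarith [P.hW]

/-- **`(n+1) · L · W_L ≤ G X L/64`** (the directional share, from the first term of `X`). [folklore] -/
theorem WL_mul_le : (n + 1) * P.L * P.WL ≤ P.G * P.X * P.L / 64 := by
  have h := P.main_le_X
  have hG : 0 < P.G := by linarith [P.eight_le_G]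
  have hL : (0 : ℝ) ≤ P.L := by linarith [P.one_le_L]
  rw [div_le_iff₀ hG] at h
  rw [le_div_iff₀ (by norm_num)]
  nlinarith

/-- `64 (n+1) ≤ G X` (so the Feldman block `H` is at its second term up to the floor). [folklore] -/
theorem GX_ge : (64 : ℝ) * (n + 1) ≤ P.G * P.X := by
  have h1 := P.cG_mul_le_G
  have h2 := P.X_ge
  unfold cG at h1
  have h0 : (0 : ℝ) ≤ n := by positivity
  nlinarith

/-- **`H ≤ G X/(64 (n+1))`**. [cite: Nesterenko2003, (3.23)] -/
theorem H_le : (P.H : ℝ) ≤ P.G * P.X / (64 * (n + 1)) := by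
  have hy : (1 : ℝ) ≤ P.G * P.X / (64 * (n + 1)) := by
    rw [le_div_iff₀ (by positivity)]; linarith [P.GX_ge]
  unfold H
  rw [Nat.cast_max, Nat.cast_one]
  exact max_le hy (Nat.floor_le (by linarith))

/-- `G X/(64 (n+1)) − 1 < H`. [folklore] -/
theorem H_gt : P.G * P.X / (64 * (n + 1)) - 1 < P.H := by
  have h1 := Nat.lt_floor_add_one (P.G * P.X / (64 * (n + 1)))
  have h2 : (⌊P.G * P.X / (64 * (n + 1))⌋₊ : ℝ) ≤ P.H := by
    unfold H; exact_mod_cast le_max_right _ _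
  linarith

/-- **`X ≤ 9 H`** (as `G ≥ 8(n+1)` and `X ≥ 72`): the ratio `|y|/H` in the `Y₀`-weights costs only
`(Ŝ + n + 4) log 2`. [folklore] -/
theorem X_le_nine_H : (P.X : ℝ) ≤ 9 * P.H := by
  have h1 := P.H_gt
  have hG := P.cG_mul_le_G
  unfold cG at hG
  have hX := P.seventytwo_le_X
  have h2 : (P.X : ℝ) / 8 ≤ P.G * P.X / (64 * (n + 1)) := by
    rw [div_le_div_iff₀ (by norm_num) (by positivity)]
    have h0 : (0 : ℝ) ≤ P.X := by linarith
    nlinarith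
  linarith

/-- `L₀ < 6 X C_bⁿ Ω K + 1`. [folklore] -/
theorem L₀_lt : (P.L₀ : ℝ) < 6 * P.X * Cb ^ n * P.Ω * P.K + 1 := by
  unfold L₀
  exact Nat.ceil_lt_add_one (by have := Cb_pos; have := P.Ω_pos; have := P.K_pos; positivity)

/-- `6 X C_bⁿ Ω K ≤ L₀`. [folklore] -/
theorem L₀_ge : 6 * P.X * Cb ^ n * P.Ω * P.K ≤ P.L₀ := by unfold L₀; exact Nat.le_ceil _

/-- **`L₀ ≤ G X L/(4 · yload) + 1`**: the `Y₀`-degree times its logarithmic load is a quarter of the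
budget unit `G X L`. [folklore] -/
theorem L₀_le : (P.L₀ : ℝ) ≤ P.G * P.X * P.L / (4 * P.yload) + 1 := by
  have h1 := P.L₀_lt
  have h2 := P.core_le
  have hY := P.yload_pos
  have hX : (0 : ℝ) ≤ P.X := by linarith [P.seventytwo_le_X]
  have h3 : 6 * P.X * Cb ^ n * P.Ω * P.K ≤ P.G * P.X * P.L / (4 * P.yload) := by
    have : 6 * P.X * (Cb ^ n * P.Ω * P.K) ≤ 6 * P.X * (P.L * P.G / (24 * P.yload)) :=
      mul_le_mul_of_nonneg_left h2 (by positivity)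
    have e : 6 * P.X * (P.L * P.G / (24 * P.yload)) = P.G * P.X * P.L / (4 * P.yload) := by
      field_simp; ring
    calc 6 * P.X * Cb ^ n * P.Ω * P.K = 6 * P.X * (Cb ^ n * P.Ω * P.K) := by ring
      _ ≤ _ := this
      _ = _ := e
  linarith

/-- `L₀ · yload ≤ G X L/4 + yload`. [folklore] -/
theorem L₀_mul_yload_le : P.L₀ * P.yload ≤ P.G * P.X * P.L / 4 + P.yload := by
  have h := P.L₀_le
  have hY := P.yload_pos
  have := mul_le_mul_of_nonneg_right h hY.le
  have e : (P.G * P.X * P.L / (4 * P.yload) + 1) * P.yload = P.G * P.X * P.L / 4 + P.yload := by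
    field_simp
  linarith

/-- `60 ≤ C_bⁿ Ω K` (`C_b log 2 = 32 e log 2 > 60`). [folklore] -/
theorem sixty_le_core : 60 ≤ Cb ^ n * P.Ω * P.K := by
  have h1 : (60 : ℝ) ≤ Cb * Real.log 2 := by
    unfold Cb cM
    have := Real.exp_one_gt_d9; have := Real.log_two_gt_d9
    push_cast; nlinarith
  have h2 : Cb * Real.log 2 ≤ (Cb * Real.log 2) ^ n :=
    le_self_pow₀ (by linarith) (by have := P.hn; omega)
  have h3 : (Cb * Real.log 2) ^ n ≤ Cb ^ n * P.Ω := by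
    rw [mul_pow]; exact mul_le_mul_of_nonneg_left P.log_two_pow_le_Ω (by have := Cb_pos; positivity)
  have h4 : Cb ^ n * P.Ω ≤ Cb ^ n * P.Ω * P.K := by
    have hK : (1 : ℝ) ≤ P.K := by exact_mod_cast P.one_le_K
    have : 0 ≤ Cb ^ n * P.Ω := by have := Cb_pos; have := P.Ω_pos; positivity
    nlinarith
  linarith

/-- **`yload ≤ G L/1440`** (so every `X`-free logarithm is negligible against `G X L`). [folklore] -/
theorem yload_le : P.yload ≤ P.G * P.L / 1440 := by
  have h := P.main_le_L
  have hG : 0 < P.G := by linarith [P.eight_le_G]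
  have hc := P.sixty_le_core
  have hY := P.yload_pos
  rw [div_le_iff₀ hG] at h
  rw [le_div_iff₀ (by norm_num)]
  nlinarith

/-- `M = 16 (n+1) L` (real). [folklore] -/
theorem M_real : (P.M : ℝ) = 16 * (n + 1) * P.L := by rw [P.M_eq]; push_cast; ring

/-- `Mord 0 0 = M/(n+2)³ + M` (the total order at level `0`, Nesterenko's `M̂`). [cite: Nesterenko2003, (3.25)] -/
theorem Mord_zero_zero : P.Mord 0 0 = P.M / (n + 2) ^ 3 + P.M := by
  simp only [Mord, P.T_zero, Nat.sub_zero, P.M_eq]; ring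

/-- **`Mord 0 0 ≤ (28/27) M`**. [cite: Nesterenko2003, (3.25)] -/
theorem Mord_zero_zero_le : (P.Mord 0 0 : ℝ) ≤ (28 / 27) * P.M := by
  rw [P.Mord_zero_zero]; push_cast
  have h1 : P.M / (n + 2) ^ 3 ≤ P.M / 27 :=
    Nat.div_le_div_left (le_trans (by norm_num) (Nat.pow_le_pow_left (show 3 ≤ n + 2 by have := P.hn; omega) 3))
      (by norm_num)
  have h2 : ((P.M / (n + 2) ^ 3 : ℕ) : ℝ) ≤ (P.M : ℝ) / 27 := by
    calc ((P.M / (n + 2) ^ 3 : ℕ) : ℝ) ≤ ((P.M / 27 : ℕ) : ℝ) := by exact_mod_cast h1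
      _ ≤ (P.M : ℝ) / 27 := Nat.cast_div_le
  linarith

/-- `Mord 0 0 ≤ (448/27)(n+1) L < 16.6 (n+1) L`. [folklore] -/
theorem Mord_zero_zero_le' : (P.Mord 0 0 : ℝ) ≤ (448 / 27) * (n + 1) * P.L := by
  have h := P.Mord_zero_zero_le; rw [P.M_real] at h; linarith

/-- `n ≤ G/8 − 1`. [folklore] -/
theorem n_le : (n : ℝ) ≤ P.G / 8 - 1 := by
  have h := P.cG_mul_le_G; unfold cG at h; linarith

/-! ### The schedule in real form -/

/-- `X_s (T_s + 1) ≤ 4 X L`. [cite: Nesterenko2003, (4.3)] -/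
theorem Xs_mul_le (s : ℕ) : (P.Xs s : ℝ) * (P.T s + 1) ≤ 4 * P.X * P.L := by
  unfold Xs; exact_mod_cast Nat.div_mul_le_self (4 * P.X * P.L) (P.T s + 1)

/-- `4 X L − (T_s + 1) ≤ X_s (T_s + 1)` (the floor loses less than one multiplicity). [folklore] -/
theorem Xs_mul_ge (s : ℕ) : 4 * P.X * P.L - (P.T s + 1) ≤ (P.Xs s : ℝ) * (P.T s + 1) := by
  have h := Nat.lt_div_mul_add (a := 4 * P.X * P.L) (b := P.T s + 1) (by positivity)
  unfold Xs
  have h' : ((4 * P.X * P.L : ℕ) : ℝ) < ((4 * P.X * P.L / (P.T s + 1) * (P.T s + 1) + (P.T s + 1) : ℕ) : ℝ) := by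
    exact_mod_cast h
  push_cast at h'
  linarith

/-- `T_s ≤ 8 L`. [cite: Nesterenko2003, (4.3)] -/
theorem T_le (s : ℕ) : P.T s ≤ 8 * P.L := by unfold T; exact Nat.div_le_self _ _

/-- **`(31/8) X L ≤ X_s (T_s + 1)`** (as `X ≥ 72`). [cite: Nesterenko2003, (4.25)] -/
theorem Xs_mul_ge' (s : ℕ) : (31 / 8 : ℝ) * P.X * P.L ≤ (P.Xs s : ℝ) * (P.T s + 1) := by
  have h1 := P.Xs_mul_ge s
  have h2 : (P.T s : ℝ) ≤ 8 * P.L := by exact_mod_cast P.T_le s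
  have hX := P.seventytwo_le_X
  have hL := P.one_le_L
  nlinarith

/-- `1 ≤ X_s` at every level. [folklore] -/
theorem one_le_Xs (s : ℕ) : 1 ≤ P.Xs s := by
  unfold Xs
  rw [Nat.one_le_div_iff (by positivity)]
  have h1 := P.T_le s
  have h2 := P.seventytwo_le_X'
  have h3 : 72 * P.L ≤ P.X * P.L := Nat.mul_le_mul_right _ h2
  have h4 : 1 ≤ P.L := le_trans Nat.one_le_two_pow P.two_pow_le_L
  nlinarith [h3, h4]

/-- `X_s ≤ 2^s X/2` (real; indeed `<`). [cite: Nesterenko2003, (4.24)] -/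
theorem Xs_le (s : ℕ) : (P.Xs s : ℝ) ≤ 2 ^ s * P.X / 2 := by
  have h1 := P.Xs_mul_le s
  have h2 : (8 : ℝ) * P.L < 2 ^ s * (P.T s + 1) := by exact_mod_cast P.lt_two_pow_mul_T_succ s
  have hT : (0 : ℝ) < P.T s + 1 := by positivity
  have hX : (0 : ℝ) ≤ P.X := by linarith [P.seventytwo_le_X]
  have hXs : (0 : ℝ) ≤ P.Xs s := by positivity
  -- `Xs (T+1) ≤ 4 X L < X · 2^s (T+1)/2`
  by_contra hc
  push Not at hc
  have h3 : 2 ^ s * P.X / 2 * ((P.T s : ℝ) + 1) < (P.Xs s : ℝ) * (P.T s + 1) :=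
    mul_lt_mul_of_pos_right hc hT
  have h4 : 4 * (P.X : ℝ) * P.L ≤ 2 ^ s * P.X / 2 * ((P.T s : ℝ) + 1) := by nlinarith
  linarith

/-- The Schwarz exponent available at stage `(s, ν)`: gain `G` per zero, `≥ 2^{ν+1} X_s` nodes of
multiplicity `T_s + 1`. [cite: Nesterenko2003, (4.25)] -/
def zeros (s ν : ℕ) : ℝ := P.G * (2 ^ (ν + 1) * P.Xs s) * (P.T s + 1)

/-- **`(31/4) · 2^ν · G X L ≤ zeros s ν`**. [cite: Nesterenko2003, (4.25)] -/
theorem zeros_ge (s ν : ℕ) : (31 / 4 : ℝ) * 2 ^ ν * (P.G * P.X * P.L) ≤ P.zeros s ν := by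
  unfold zeros
  have h := P.Xs_mul_ge' s
  have hG : 0 < P.G := by linarith [P.eight_le_G]
  have h2 : (0 : ℝ) < 2 ^ ν := by positivity
  have e : P.G * (2 ^ (ν + 1) * (P.Xs s : ℝ)) * (P.T s + 1) =
      2 * 2 ^ ν * P.G * ((P.Xs s : ℝ) * (P.T s + 1)) := by rw [pow_succ]; ring
  rw [e]
  nlinarith [mul_pos h2 hG]

end PadicG3Par

end Summit.ABC.StewartYu
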